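import Summits.HodgeConjecture.HodgeConjecture.Theses.AnchorTransport
import Summits.HodgeConjecture.HodgeConjecture.Theorems.AnchorTransportVariationalHodgeReductions
import Summits.HodgeConjecture.HodgeConjecture.Theorems.AnchorTransportVariationalHodgeCorrespondenceTransport

/-!
# Route AnchorTransport — `VariationalHodge` (stmt-HodgeConjecture-1076): the operator-supply form of the crux is the crux

The idea card `gw-section-transport` of the crux (workfile `Cruxes/VariationalHodge/Ideas/`) proves an
instance of Grothendieck's variational Hodge statement by TRANSPORTING the anchor: operators
`T_t : H²ᵖ(𝒳_{s₀}(ℂ)) → H²ᵖ(𝒳_t(ℂ))` (actions `[Γ_t]^*` of the fibres of a relative correspondence)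
which preserve algebraic classes, act FLATLY on an algebraic anchor class `α₀` (the transports
`T_t α₀` are the fibre restrictions of one global class — proper base change for a cycle `Γ` on
`𝒳 × 𝒳_{s₀}`), and hit the anchor value, `T_{s₀} α₀ = A|_{𝒳_{s₀}}` (non-vanishing "anchor
coefficient", Cayley–Hamilton form `α₀ = r(E)·A|_{s₀}` included). The abstract transport theorem is
landed (`mem_algebraicClasses_of_transportedAnchor`, `correspondenceTransport`).

This file records the COSTUME TEST run by the line lead on the reshaped skeleton
`Cruxes/VariationalHodge/Lines/Sketch.lean` (one registered stub `stub_anchoredOperatorSupply`): the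
ABSTRACT operator-supply statement — "for every smooth projective family over a smooth irreducible
affine base, every fibrewise rational `(p,p)` global class algebraic at `s₀` admits such `(T, α₀)`" —
is EQUIVALENT to the crux `AnchorTransport.VariationalHodge`:

* `variationalHodge_of_anchoredOperatorSupply` — supply ⇒ crux (flat continuation is unique over an
  irreducible base, `complexBetti_map_fiberι_eq_of_eq`, plus the landed reduction to affine bases
  `variationalHodge_of_affine`);
* `anchoredOperatorSupply_of_variationalHodge` — crux ⇒ supply, with the tautological operators
  `T_t c := if c = A|_{𝒳_{s₀}} then A|_{𝒳_t} else 0`, `α₀ := A|_{𝒳_{s₀}}`, `Gl := A`;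
* `anchoredOperatorSupply_iff_variationalHodge` — the equivalence.

Consequence for crux lines: abstract operator / correspondence transport carries NO content beyond the
crux; a line of this type has content only in the CONSTRUCTION of `T` (an explicit algebraic cycle on
`𝒳 × 𝒳_{s₀}` and the computation of its anchor coefficient), which the tree cannot yet type (no
relative cycles / flat limits / section spaces). No rationality or Hodge-type hypothesis is used in
either direction beyond passing it along.
-/

noncomputable section

-- every declaration of this problem lives in `Summit.HodgeConjecture.HodgeConjecture.…` (summit = sub-problem)
set_option linter.dupNamespace false

open CategoryTheory AlgebraicGeometry TopologicalSpace MonoidalCategory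
open Literature.AlgebraicGeometry.Motives Literature.AlgebraicGeometry.HodgeTheory
open Summit.HodgeConjecture.HodgeConjecture.Theses.AnchorTransport

namespace Summit.HodgeConjecture.HodgeConjecture.Theorems

/-- **Anchored operator supply ⇒ the variational Hodge crux.** If over every smooth irreducible
affine base every fibrewise rational `(p,p)` global class `A` algebraic at `s₀` admits
algebraicity-preserving operators `T_t : H²ᵖ(𝒳_{s₀}) → H²ᵖ(𝒳_t)` and an algebraic `α₀` with
`T_t α₀ = Gl|_{𝒳_t}` for one global class `Gl` and `T_{s₀} α₀ = A|_{𝒳_{s₀}}`, then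
`AnchorTransport.VariationalHodge` holds: `Gl` and `A` agree on the anchor fibre, hence on every
fibre of the irreducible affine base (`complexBetti_map_fiberι_eq_of_eq`), so `A|_{𝒳_t} = T_t α₀` is
algebraic; the crux reduces to affine bases by `variationalHodge_of_affine`. [folklore] -/
theorem variationalHodge_of_anchoredOperatorSupply
    (hsup : ∀ ⦃n : ℕ⦄ ⦃𝒳 S : SchemeOver ℂ⦄ (f : 𝒳 ⟶ S), IsSmoothProjectiveFamily f n →
      IrreducibleSpace S.left → IsAffine S.left → AlgebraicGeometry.Smooth S.hom →
      ∀ (p : ℕ) (A : complexBetti 𝒳 (2 * p)),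
      (∀ s : ComplexPoints S, IsRationalClass (complexBetti.map (fiberι f s) (2 * p) A) ∧
        IsOfHodgeType n (fiberOver f s) (2 * p) p p (complexBetti.map (fiberι f s) (2 * p) A)) →
      ∀ s₀ : ComplexPoints S,
        complexBetti.map (fiberι f s₀) (2 * p) A ∈ algebraicClasses (fiberOver f s₀) p →
      ∃ T : ∀ t : ComplexPoints S,
          complexBetti (fiberOver f s₀) (2 * p) → complexBetti (fiberOver f t) (2 * p),
        (∀ (t : ComplexPoints S) (c : complexBetti (fiberOver f s₀) (2 * p)),
          c ∈ algebraicClasses (fiberOver f s₀) p → T t c ∈ algebraicClasses (fiberOver f t) p) ∧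
        ∃ α₀ : complexBetti (fiberOver f s₀) (2 * p), α₀ ∈ algebraicClasses (fiberOver f s₀) p ∧
          (∃ Gl : complexBetti 𝒳 (2 * p), ∀ t : ComplexPoints S,
            T t α₀ = complexBetti.map (fiberι f t) (2 * p) Gl) ∧
          T s₀ α₀ = complexBetti.map (fiberι f s₀) (2 * p) A) :
    VariationalHodge := by
  refine variationalHodge_of_affine fun n 𝒳 S f hf hirr haff hsm p A hA hs₀ s => ?_
  obtain ⟨s₀, hs₀⟩ := hs₀
  obtain ⟨T, halg, α₀, hα₀, ⟨Gl, hGl⟩, hfix⟩ := hsup f hf hirr haff hsm p A hA s₀ hs₀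
  haveI := hirr
  haveI := haff
  haveI := hsm
  haveI : IsAffineHom S.hom := inferInstance
  haveI : IsSeparated S.hom := inferInstance
  haveI : CompactSpace S.left := isCompact_univ_iff.mp (isAffineOpen_top S.left).isCompact
  -- `Gl` and `A` agree on the anchor fibre, hence on every fibre
  have h₀ : complexBetti.map (fiberι f s₀) (2 * p) Gl = complexBetti.map (fiberι f s₀) (2 * p) A := by
    rw [← hGl s₀, hfix]
  have hs : complexBetti.map (fiberι f s) (2 * p) Gl = complexBetti.map (fiberι f s) (2 * p) A :=
    complexBetti_map_fiberι_eq_of_eq f hf (2 * p) Gl A s₀ s h₀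
  rw [← hs, ← hGl s]
  exact halg s α₀ hα₀

/-- **The variational Hodge crux ⇒ anchored operator supply** (the tautological operators): given
`AnchorTransport.VariationalHodge`, for `A` fibrewise rational `(p,p)` and algebraic at `s₀` put
`T_t c := A|_{𝒳_t}` if `c = A|_{𝒳_{s₀}}` and `T_t c := 0` otherwise, `α₀ := A|_{𝒳_{s₀}}`, `Gl := A`;
`T_t` preserves algebraic classes because the crux makes every `A|_{𝒳_t}` algebraic. So the abstract
operator-supply statement has no content beyond the crux. [folklore] -/
theorem anchoredOperatorSupply_of_variationalHodge (hV : VariationalHodge)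
    ⦃n : ℕ⦄ ⦃𝒳 S : SchemeOver ℂ⦄ (f : 𝒳 ⟶ S) (hf : IsSmoothProjectiveFamily f n)
    (hirr : IrreducibleSpace S.left) (_haff : IsAffine S.left) (hsm : AlgebraicGeometry.Smooth S.hom)
    (p : ℕ) (A : complexBetti 𝒳 (2 * p))
    (hA : ∀ s : ComplexPoints S, IsRationalClass (complexBetti.map (fiberι f s) (2 * p) A) ∧
      IsOfHodgeType n (fiberOver f s) (2 * p) p p (complexBetti.map (fiberι f s) (2 * p) A))
    (s₀ : ComplexPoints S)
    (hs₀ : complexBetti.map (fiberι f s₀) (2 * p) A ∈ algebraicClasses (fiberOver f s₀) p) :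
    ∃ T : ∀ t : ComplexPoints S,
        complexBetti (fiberOver f s₀) (2 * p) → complexBetti (fiberOver f t) (2 * p),
      (∀ (t : ComplexPoints S) (c : complexBetti (fiberOver f s₀) (2 * p)),
        c ∈ algebraicClasses (fiberOver f s₀) p → T t c ∈ algebraicClasses (fiberOver f t) p) ∧
      ∃ α₀ : complexBetti (fiberOver f s₀) (2 * p), α₀ ∈ algebraicClasses (fiberOver f s₀) p ∧
        (∃ Gl : complexBetti 𝒳 (2 * p), ∀ t : ComplexPoints S,
          T t α₀ = complexBetti.map (fiberι f t) (2 * p) Gl) ∧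
        T s₀ α₀ = complexBetti.map (fiberι f s₀) (2 * p) A := by
  classical
  have hall : ∀ t : ComplexPoints S,
      complexBetti.map (fiberι f t) (2 * p) A ∈ algebraicClasses (fiberOver f t) p :=
    hV f hf hirr hsm p A hA ⟨s₀, hs₀⟩
  refine ⟨fun t c => if c = complexBetti.map (fiberι f s₀) (2 * p) A then
      complexBetti.map (fiberι f t) (2 * p) A else 0, ?_, complexBetti.map (fiberι f s₀) (2 * p) A,
    hs₀, ⟨A, fun t => ?_⟩, ?_⟩
  · intro t c _
    dsimp only
    split_ifs
    · exact hall t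
    · exact zero_mem _
  · dsimp only
    rw [if_pos rfl]
  · dsimp only
    rw [if_pos rfl]

/-- **The operator-supply form of the crux is equivalent to the crux** (costume certificate for the
abstract `gw-section-transport` skeleton `Cruxes/VariationalHodge/Lines/Sketch.lean`): its one stub
`stub_anchoredOperatorSupply` is, verbatim, the left-hand side. [folklore] -/
theorem anchoredOperatorSupply_iff_variationalHodge :
    (∀ ⦃n : ℕ⦄ ⦃𝒳 S : SchemeOver ℂ⦄ (f : 𝒳 ⟶ S), IsSmoothProjectiveFamily f n →
      IrreducibleSpace S.left → IsAffine S.left → AlgebraicGeometry.Smooth S.hom →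
      ∀ (p : ℕ) (A : complexBetti 𝒳 (2 * p)),
      (∀ s : ComplexPoints S, IsRationalClass (complexBetti.map (fiberι f s) (2 * p) A) ∧
        IsOfHodgeType n (fiberOver f s) (2 * p) p p (complexBetti.map (fiberι f s) (2 * p) A)) →
      ∀ s₀ : ComplexPoints S,
        complexBetti.map (fiberι f s₀) (2 * p) A ∈ algebraicClasses (fiberOver f s₀) p →
      ∃ T : ∀ t : ComplexPoints S,
          complexBetti (fiberOver f s₀) (2 * p) → complexBetti (fiberOver f t) (2 * p),
        (∀ (t : ComplexPoints S) (c : complexBetti (fiberOver f s₀) (2 * p)),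
          c ∈ algebraicClasses (fiberOver f s₀) p → T t c ∈ algebraicClasses (fiberOver f t) p) ∧
        ∃ α₀ : complexBetti (fiberOver f s₀) (2 * p), α₀ ∈ algebraicClasses (fiberOver f s₀) p ∧
          (∃ Gl : complexBetti 𝒳 (2 * p), ∀ t : ComplexPoints S,
            T t α₀ = complexBetti.map (fiberι f t) (2 * p) Gl) ∧
          T s₀ α₀ = complexBetti.map (fiberι f s₀) (2 * p) A) ↔
    VariationalHodge :=
  ⟨variationalHodge_of_anchoredOperatorSupply, fun hV _ _ _ f hf hirr haff hsm p A hA s₀ hs₀ =>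
    anchoredOperatorSupply_of_variationalHodge hV f hf hirr haff hsm p A hA s₀ hs₀⟩

end Summit.HodgeConjecture.HodgeConjecture.Theorems

end
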